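import Literature.Analysis.FluidPDE.TorusPressurePoissonOfDistributional
import Literature.Analysis.FunctionSpaces.TorusWeaklyHarmonic
import Literature.Analysis.FunctionSpaces.TorusRieszTransformProofs
import Literature.Analysis.FunctionSpaces.BesovDifference
import HarnessLib

/-!
# Besov regularity of the pressure of a distributional Euler/Navier–Stokes solution on `T^d`

Analysis/FluidPDE support file (theorem-only; serves the discharge of
`Literature.Barriers.AnomalousDissipation.DeRosaIsett2024_s51_finalBound`). De Rosa–Isett
(ARMA 248 (2024) = arXiv:2212.08176), §3.4 and §5.1 ((est_II), "the double regularity of the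
pressure (p_double_reg)"), use that the pressure of a weak Euler solution `v ∈ L^p_t B^θ_{p,∞}`
inherits Besov regularity through the Calderón–Zygmund operator `p = RᵢRⱼ(vᵢvⱼ)`. In the tree's
symmetric Duchon–Robert form of §5.1 only *single* regularity is needed
(`IntermittentDissipationThm27Steps`, module docstring), and the pressure of `DeRosaIsett2024_thm27`
is *any* `L^{3/2}` distributional pressure. This file proves, for a distributional solution
`(u, p)` on `T^d × (0,T)` with `u(t) ∈ L^q(T^d)` for a.e. `t`, `2 < q < ∞`:

* `Torus.IsDistributionalNSSolutionOn.ae_eBesovSupSeminorm_pressure_le` — there is a finite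
  constant `C_q` (Calderón–Zygmund) with, for a.e. `t ∈ (0,T)` and every `θ`,
  `[p(t)]_{B^θ_{q/2,∞}} ≤ C_q ‖u(t)‖_{L^q} [u(t)]_{B^θ_{q,∞}}`.

Steps (all on one slice): (1) the slice-wise Poisson equation `∫ p(t)Δφ = -∑ᵢⱼ∫uᵢuⱼ(t)∂ᵢ∂ⱼφ`
(`TorusPressurePoissonOfDistributional`), made simultaneous in `t` for the countable family of
reflected mollifier translates at the points of a countable dense set; (2) the Calderón–Zygmund
pressure `π(t)` of the data `uᵢuⱼ(t) ∈ L^{q/2}` (`Torus.exists_pressure` of `TorusPressurePoisson`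
at a one-point parameter space, with the tree's proof of the Hessian bound
`Torus.eLpNorm_hessian_le_laplacian_holds`); (3) `p(t) - π(t)` is weakly harmonic for that family,
hence a.e. constant (`TorusWeaklyHarmonic`), so `p(t)` and `π(t)` have the same increments;
(4) for a very weak solution `π` of `Δπ = -∂ᵢ∂ⱼGᵢⱼ` against *all* smooth tests, the increment
`δ_hπ` minus the Calderón–Zygmund pressure of `δ_hG` is weakly harmonic, hence constant, whence
`‖δ_hπ‖_{L^r} ≤ 2 (K ∑ᵢⱼ ‖δ_hGᵢⱼ‖^r_{L^r})^{1/r}` (`Torus.eLpNorm_translate_sub_le_of_poisson`);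
(5) `δ_h(uᵢuⱼ) = δ_huᵢ · uⱼ(· + h) + uᵢ · δ_huⱼ` and Hölder `L^q · L^q ⊂ L^{q/2}`.

## Mathlib search

Mathlib (this pin): `Measure.dirac_prod`, `MeasurableEmbedding.aestronglyMeasurable_map_iff`,
`eLpNorm_smul_le_mul_eLpNorm`, `TopologicalSpace.exists_countable_dense`; no Riesz transforms /
pressure operators (tree: `TorusPressurePoisson`, `TorusRieszTransformProofs`).

## References

* L. De Rosa, P. Isett, Arch. Ration. Mech. Anal. 248 (2024), Paper No. 11, §3.4, §5.1 (est_II).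
  [DeRosaIsett2024]
* J. C. Robinson, J. L. Rodrigo, W. Sadowski, *The Three-Dimensional Navier–Stokes Equations*
  (CUP 2016), Lemma 5.1, Thm. 2.6, App. B Thm. B.7. [RobinsonRodrigoSadowskiCUP2016]
* P. Constantin, W. E, E. S. Titi, Comm. Math. Phys. 165 (1994), (9)–(11). [ConstantinETiti1994]
-/

noncomputable section

open MeasureTheory Set Filter Topology Function UnitAddTorus Metric
open scoped ENNReal NNReal InnerProductSpace RealInnerProductSpace

namespace Literature.Analysis.FluidPDE.Torus

open Literature.Analysis.FunctionSpaces Literature.Analysis.FunctionSpaces.Torus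

variable {d : Type*} [Fintype d] [DecidableEq d]

/-! ## Translation invariance of the torus calculus -/

section Translate

variable {F : Type*} [NormedAddCommGroup F] [NormedSpace ℝ F]

omit [Fintype d] [DecidableEq d] [NormedAddCommGroup F] [NormedSpace ℝ F] in
/-- Re-centred lifts of a translate: `liftAt (f(· + a)) x = liftAt f (x + a)`. [folklore] -/
theorem liftAt_comp_add_right (f : UnitAddTorus d → F) (a x : UnitAddTorus d) :
    liftAt (fun y => f (y + a)) x = liftAt f (x + a) := by
  funext v
  simp only [liftAt_apply, add_right_comm]

omit [DecidableEq d] in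
/-- The Laplacian commutes with translations: `Δ(f(· + a))(x) = (Δf)(x + a)`. [folklore] -/
theorem laplacian_comp_add_right (f : UnitAddTorus d → F) (a x : UnitAddTorus d) :
    Torus.laplacian (fun y => f (y + a)) x = Torus.laplacian f (x + a) := by
  simp only [Torus.laplacian, liftAt_comp_add_right]

omit [Fintype d] in
/-- Partial derivatives commute with translations: `∂ᵢ(f(· + a))(x) = (∂ᵢf)(x + a)`. [folklore] -/
theorem partialDeriv_comp_add_right (i : d) (f : UnitAddTorus d → F) (a x : UnitAddTorus d) :
    Torus.partialDeriv i (fun y => f (y + a)) x = Torus.partialDeriv i f (x + a) := by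
  simp only [Torus.partialDeriv, Torus.lineDeriv, add_right_comm]

omit [Fintype d] in
/-- Second partial derivatives commute with translations. [folklore] -/
theorem partialDeriv_partialDeriv_comp_add_right (i j : d) (f : UnitAddTorus d → F) (a x : UnitAddTorus d) :
    Torus.partialDeriv i (Torus.partialDeriv j (fun y => f (y + a))) x =
      Torus.partialDeriv i (Torus.partialDeriv j f) (x + a) := by
  have h : Torus.partialDeriv j (fun y => f (y + a)) = fun y => Torus.partialDeriv j f (y + a) :=
    funext (partialDeriv_comp_add_right j f a)
  rw [h, partialDeriv_comp_add_right]

end Translate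

/-! ## The Calderón–Zygmund pressure of one slice -/

section Slice

variable {r : ℝ≥0∞} {C : ℝ≥0}

/-- **The Calderón–Zygmund pressure of one tensor slice** (`Torus.exists_pressure` of
`TorusPressurePoisson` over a one-point parameter space; Robinson–Rodrigo–Sadowski 2016, Lemma 5.1):
for `Gᵢⱼ ∈ L^r(T^d)` there is `π ∈ L^r` with `∫⁻|π|^r ≤ K ∑ᵢⱼ ∫⁻|Gᵢⱼ|^r` solving
`∫ π Δφ = -∑ᵢⱼ ∫ Gᵢⱼ ∂ᵢ∂ⱼφ` for every smooth `φ`. [cite: RobinsonRodrigoSadowskiCUP2016, Lemma 5.1] -/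
theorem exists_slicePressure [Nonempty d] (hr1 : 1 ≤ r) (hrt : r ≠ ⊤) (hC : HessianBound d r C)
    {G : d → d → UnitAddTorus d → ℝ} (hGm : ∀ i j, AEStronglyMeasurable (G i j) volume)
    (hGf : ∀ i j, ∫⁻ x, ‖G i j x‖ₑ ^ r.toReal < ⊤) :
    ∃ π : UnitAddTorus d → ℝ, AEStronglyMeasurable π volume ∧
      ∫⁻ x, ‖π x‖ₑ ^ r.toReal ≤ presConst d r C * ∑ i, ∑ j, ∫⁻ x, ‖G i j x‖ₑ ^ r.toReal ∧
      ∀ φ : UnitAddTorus d → ℝ, IsSmooth φ →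
        ∫ x, π x * Torus.laplacian φ x =
          -∑ i, ∑ j, ∫ x, G i j x * Torus.partialDeriv i (Torus.partialDeriv j φ) x := by
  set μ : Measure Unit := Measure.dirac () with hμ
  have hemb : MeasurableEmbedding (Prod.mk () : UnitAddTorus d → Unit × UnitAddTorus d) :=
    measurableEmbedding_prodMk_left ()
  have hprod : μ.prod (volume : Measure (UnitAddTorus d)) = Measure.map (Prod.mk ()) volume :=
    Measure.dirac_prod _
  set G' : d → d → Unit → UnitAddTorus d → ℝ := fun i j _ x => G i j x with hG'
  have hGm' : ∀ i j, AEStronglyMeasurable (uncurry (G' i j)) (μ.prod volume) := by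
    intro i j
    rw [hprod, hemb.aestronglyMeasurable_map_iff]
    exact hGm i j
  have hlint : ∀ (F : UnitAddTorus d → ℝ≥0∞), ∫⁻ z, F z.2 ∂(μ.prod volume) = ∫⁻ x, F x := by
    intro F
    rw [hprod, hemb.lintegral_map]
  have hGf' : ∀ i j, ∫⁻ z, ‖G' i j z.1 z.2‖ₑ ^ r.toReal ∂(μ.prod volume) < ⊤ := by
    intro i j
    have := hlint (fun x => ‖G i j x‖ₑ ^ r.toReal)
    simp only [hG'] at this ⊢
    rw [this]
    exact hGf i j
  obtain ⟨P, hPm, hPb, -, hPw⟩ := exists_pressure (μ := μ) hr1 hrt hC hGm' hGf'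
  refine ⟨P (), ?_, ?_, ?_⟩
  · rw [hprod, hemb.aestronglyMeasurable_map_iff] at hPm
    exact hPm
  · have e1 : ∫⁻ x, ‖P () x‖ₑ ^ r.toReal = ∫⁻ z, ‖P z.1 z.2‖ₑ ^ r.toReal ∂(μ.prod volume) := by
      rw [hprod, hemb.lintegral_map]
    have e2 : ∀ i j, ∫⁻ x, ‖G i j x‖ₑ ^ r.toReal = ∫⁻ z, ‖G' i j z.1 z.2‖ₑ ^ r.toReal ∂(μ.prod volume) := by
      intro i j
      rw [hprod, hemb.lintegral_map]
    rw [e1]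
    simp_rw [e2]
    exact hPb
  · have h2 : ∀ᵐ a ∂(Measure.dirac ()), ∀ φ : UnitAddTorus d → ℝ, IsSmooth φ →
        ∫ x, P a x * Torus.laplacian φ x =
          -∑ i, ∑ j, ∫ x, G' i j a x * Torus.partialDeriv i (Torus.partialDeriv j φ) x := hPw
    rw [ae_dirac_eq, Filter.eventually_pure] at h2
    exact h2

end Slice

/-! ## Increments of very weak Poisson solutions -/

section TranslateBound

variable {r : ℝ≥0∞} {C : ℝ≥0}

omit [DecidableEq d] in
/-- From a finite `∫⁻ ‖f‖ₑ^r` and measurability to `MemLp f r` (`0 < r < ∞`). [folklore] -/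
theorem memLp_of_lintegral_rpow_enorm_lt_top {f : UnitAddTorus d → ℝ} (hr0 : r ≠ 0) (hrt : r ≠ ⊤)
    (hm : AEStronglyMeasurable f volume) (h : ∫⁻ x, ‖f x‖ₑ ^ r.toReal < ⊤) : MemLp f r volume := by
  refine ⟨hm, ?_⟩
  rw [eLpNorm_eq_lintegral_rpow_enorm_toReal hr0 hrt]
  exact ENNReal.rpow_lt_top_of_nonneg (by positivity) h.ne

omit [DecidableEq d] in
/-- `∫⁻ ‖f‖ₑ^r = ‖f‖^r_{L^r}` (`0 < r < ∞`). [folklore] -/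
theorem lintegral_rpow_enorm_eq_eLpNorm_rpow {f : UnitAddTorus d → ℝ} (hr0 : r ≠ 0) (hrt : r ≠ ⊤) :
    ∫⁻ x, ‖f x‖ₑ ^ r.toReal = eLpNorm f r volume ^ r.toReal := by
  have hrr : 0 < r.toReal := ENNReal.toReal_pos hr0 hrt
  rw [eLpNorm_eq_lintegral_rpow_enorm_toReal hr0 hrt, one_div, ENNReal.rpow_inv_rpow hrr.ne']

omit [DecidableEq d] in
/-- Products with bounded continuous functions are integrable. [folklore] -/
theorem integrable_mul_continuous_real {f : UnitAddTorus d → ℝ} (hf : Integrable f volume)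
    {g : UnitAddTorus d → ℝ} (hg : Continuous g) : Integrable (fun x => f x * g x) volume := by
  obtain ⟨B, hB⟩ := exists_forall_norm_le_of_continuous hg
  exact hf.mul_bdd hg.aestronglyMeasurable (ae_of_all _ hB)

/-- **Increments of a very weak Poisson solution** (the Calderón–Zygmund bound for translates, up to
the constant removed by Weyl's lemma): let `π ∈ L¹(T^d)` solve `∫ π Δφ = -∑ᵢⱼ ∫ Gᵢⱼ ∂ᵢ∂ⱼφ` for all
smooth `φ`, with `Gᵢⱼ ∈ L^r`, `1 ≤ r < ∞`, and let `K = presConst d r C` be the constant of the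
Calderón–Zygmund pressure operator (`HessianBound d r C`). Then for every `h`,
`‖π(· + h) - π‖_{L^r} ≤ 2 (K ∑ᵢⱼ ‖Gᵢⱼ(· + h) - Gᵢⱼ‖^r_{L^r})^{1/r}`: the increment `δ_hπ` and the
Calderón–Zygmund pressure `π'` of the data `δ_hG` solve the same very weak Poisson equation, so
`δ_hπ - π'` is a.e. constant (`Torus.ae_eq_const_of_forall_integral_mul_laplacian_eq_zero`), the
constant being `-∫π'`, of modulus `≤ ‖π'‖_{L^r}`. [cite: RobinsonRodrigoSadowskiCUP2016, Lemma 5.1 and Thm. 2.6] -/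
theorem eLpNorm_translate_sub_le_of_poisson [Nonempty d] (hr1 : 1 ≤ r) (hrt : r ≠ ⊤)
    (hC : HessianBound d r C) {π : UnitAddTorus d → ℝ} (hπ : Integrable π volume)
    {G : d → d → UnitAddTorus d → ℝ} (hG : ∀ i j, MemLp (G i j) r volume)
    (hPois : ∀ φ : UnitAddTorus d → ℝ, IsSmooth φ →
      ∫ x, π x * Torus.laplacian φ x =
        -∑ i, ∑ j, ∫ x, G i j x * Torus.partialDeriv i (Torus.partialDeriv j φ) x)
    (h : UnitAddTorus d) :
    eLpNorm (fun x => π (x + h) - π x) r volume ≤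
      2 * (presConst d r C * ∑ i, ∑ j, ∫⁻ x, ‖G i j (x + h) - G i j x‖ₑ ^ r.toReal) ^ (1 / r.toReal) := by
  have hr0 : r ≠ 0 := (zero_lt_one.trans_le hr1).ne'
  have hrr : 0 < r.toReal := ENNReal.toReal_pos hr0 hrt
  have hmp : MeasurePreserving (fun x : UnitAddTorus d => x + h) volume volume :=
    measurePreserving_add_right volume h
  -- the data of the increment
  set δG : d → d → UnitAddTorus d → ℝ := fun i j x => G i j (x + h) - G i j x with hδG
  have hδG : ∀ i j, MemLp (δG i j) r volume := fun i j =>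
    ((hG i j).comp_measurePreserving hmp).sub (hG i j)
  have hδGf : ∀ i j, ∫⁻ x, ‖δG i j x‖ₑ ^ r.toReal < ⊤ := fun i j =>
    lintegral_rpow_enorm_lt_top_of_eLpNorm_lt_top hr0 hrt (hδG i j).eLpNorm_lt_top
  obtain ⟨π', hπ'm, hπ'b, hπ'w⟩ := exists_slicePressure hr1 hrt hC (fun i j => (hδG i j).1) hδGf
  set S : ℝ≥0∞ := presConst d r C * ∑ i, ∑ j, ∫⁻ x, ‖δG i j x‖ₑ ^ r.toReal with hS
  have hSt : S < ⊤ := by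
    refine ENNReal.mul_lt_top (presConst_lt_top hr1 hrt) ?_
    exact ENNReal.sum_lt_top.2 fun i _ => ENNReal.sum_lt_top.2 fun j _ => hδGf i j
  have hπ'p : MemLp π' r volume :=
    memLp_of_lintegral_rpow_enorm_lt_top hr0 hrt hπ'm (hπ'b.trans_lt hSt)
  have hπ'i : Integrable π' volume := hπ'p.integrable hr1
  have hπ'norm : eLpNorm π' r volume ≤ S ^ (1 / r.toReal) := by
    rw [eLpNorm_eq_lintegral_rpow_enorm_toReal hr0 hrt]
    exact ENNReal.rpow_le_rpow hπ'b (by positivity)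
  -- the translate of `π`
  have hπh : Integrable (fun x => π (x + h)) volume := (hmp.integrable_comp hπ.aestronglyMeasurable).2 hπ
  have hGi : ∀ i j, Integrable (G i j) volume := fun i j => (hG i j).integrable hr1
  have hGhi : ∀ i j, Integrable (fun x => G i j (x + h)) volume := fun i j =>
    (hmp.integrable_comp (hGi i j).aestronglyMeasurable).2 (hGi i j)
  -- `δ_hπ - π'` is weakly harmonic
  set F : UnitAddTorus d → ℝ := fun x => π (x + h) - π x - π' x with hF
  have hFi : Integrable F volume := (hπh.sub hπ).sub hπ'i
  have hharm : ∀ φ : UnitAddTorus d → ℝ, IsSmooth φ → ∫ x, F x * Torus.laplacian φ x = 0 := by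
    intro φ hφ
    have hΔc : Continuous (Torus.laplacian φ) := hφ.laplacian.continuous
    have hφh : IsSmooth (fun x => φ (x + -h)) := hφ.comp_add_right (-h)
    have hHc : ∀ i j, Continuous (Torus.partialDeriv i (Torus.partialDeriv j φ)) := fun i j =>
      ((hφ.partialDeriv j).partialDeriv i).continuous
    -- the translated test function
    have e1 : ∫ x, π (x + h) * Torus.laplacian φ x =
        -∑ i, ∑ j, ∫ x, G i j (x + h) * Torus.partialDeriv i (Torus.partialDeriv j φ) x := by
      have h1 : ∫ x, π (x + h) * Torus.laplacian φ x =
          ∫ x, π x * Torus.laplacian (fun y => φ (y + -h)) x := by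
        have h2 : (fun x => π x * Torus.laplacian (fun y => φ (y + -h)) x) =
            fun x => π x * Torus.laplacian φ (x + -h) := by
          funext x
          rw [laplacian_comp_add_right]
        rw [h2, ← integral_add_right_eq_self (fun x => π x * Torus.laplacian φ (x + -h)) h]
        simp only [add_neg_cancel_right]
      rw [h1, hPois _ hφh]
      refine congrArg Neg.neg (Finset.sum_congr rfl fun i _ => Finset.sum_congr rfl fun j _ => ?_)
      have h3 : (fun x => G i j x * Torus.partialDeriv i (Torus.partialDeriv j (fun y => φ (y + -h))) x) =
          fun x => G i j x * Torus.partialDeriv i (Torus.partialDeriv j φ) (x + -h) := by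
        funext x
        rw [partialDeriv_partialDeriv_comp_add_right]
      rw [h3, ← integral_add_right_eq_self
        (fun x => G i j x * Torus.partialDeriv i (Torus.partialDeriv j φ) (x + -h)) h]
      simp only [add_neg_cancel_right]
    have e2 := hPois φ hφ
    have e3 : ∫ x, π' x * Torus.laplacian φ x =
        -∑ i, ∑ j, ((∫ x, G i j (x + h) * Torus.partialDeriv i (Torus.partialDeriv j φ) x) -
          ∫ x, G i j x * Torus.partialDeriv i (Torus.partialDeriv j φ) x) := by
      rw [hπ'w φ hφ]
      refine congrArg Neg.neg (Finset.sum_congr rfl fun i _ => Finset.sum_congr rfl fun j _ => ?_)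
      rw [← integral_sub (integrable_mul_continuous_real (hGhi i j) (hHc i j))
        (integrable_mul_continuous_real (hGi i j) (hHc i j))]
      refine integral_congr_ae (ae_of_all _ fun x => ?_)
      ring
    have i1 : Integrable (fun x => π (x + h) * Torus.laplacian φ x) volume := integrable_mul_continuous_real hπh hΔc
    have i2 : Integrable (fun x => π x * Torus.laplacian φ x) volume := integrable_mul_continuous_real hπ hΔc
    have i3 : Integrable (fun x => π' x * Torus.laplacian φ x) volume := integrable_mul_continuous_real hπ'i hΔc
    have hsplit : ∫ x, F x * Torus.laplacian φ x =
        (∫ x, π (x + h) * Torus.laplacian φ x) - (∫ x, π x * Torus.laplacian φ x) -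
          ∫ x, π' x * Torus.laplacian φ x := by
      have i12 : Integrable (fun x => π (x + h) * Torus.laplacian φ x - π x * Torus.laplacian φ x)
          volume := i1.sub i2
      rw [← integral_sub i1 i2, ← integral_sub i12 i3]
      refine integral_congr_ae (ae_of_all _ fun x => ?_)
      simp only [hF]
      ring
    rw [hsplit, e1, e2, e3]
    simp only [Finset.sum_sub_distrib]
    ring
  -- hence a.e. constant, with constant `-∫ π'`
  have hconst := ae_eq_const_of_forall_integral_mul_laplacian_eq_zero hFi hharm
  have hintF : ∫ x, F x = -∫ x, π' x := by
    have i12 : Integrable (fun x => π (x + h) - π x) volume := hπh.sub hπ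
    simp only [hF]
    rw [integral_sub i12 hπ'i, integral_sub hπh hπ, integral_add_right_eq_self, sub_self,
      zero_sub]
  set c : ℝ := -∫ x, π' x with hc
  have hae : (fun x => π (x + h) - π x) =ᵐ[volume] fun x => π' x + c := by
    filter_upwards [hconst] with x hx
    have hx' : π (x + h) - π x - π' x = c := by rw [← hintF]; exact hx
    linarith
  -- the `L^r` bound
  have hcnorm : ‖c‖ₑ ≤ eLpNorm π' r volume := by
    rw [hc, enorm_neg]
    calc ‖∫ x, π' x‖ₑ ≤ ∫⁻ x, ‖π' x‖ₑ := enorm_integral_le_lintegral_enorm _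
      _ = eLpNorm π' 1 volume := eLpNorm_one_eq_lintegral_enorm.symm
      _ ≤ eLpNorm π' r volume := eLpNorm_le_eLpNorm_of_exponent_le hr1 hπ'm
  calc eLpNorm (fun x => π (x + h) - π x) r volume
      = eLpNorm (fun x => π' x + c) r volume := eLpNorm_congr_ae hae
    _ ≤ eLpNorm π' r volume + eLpNorm (fun _ : UnitAddTorus d => c) r volume :=
        eLpNorm_add_le hπ'm aestronglyMeasurable_const hr1
    _ = eLpNorm π' r volume + ‖c‖ₑ := by
        rw [eLpNorm_const c hr0 (NeZero.ne volume), measure_univ, ENNReal.one_rpow, mul_one]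
    _ ≤ S ^ (1 / r.toReal) + S ^ (1 / r.toReal) := add_le_add hπ'norm (hcnorm.trans hπ'norm)
    _ = 2 * S ^ (1 / r.toReal) := (two_mul _).symm

end TranslateBound

/-! ## The pressure of a distributional solution -/

section Distributional

variable {T ν : ℝ} {u : ℝ → UnitAddTorus d → EuclideanSpace ℝ d} {p : ℝ → UnitAddTorus d → ℝ}

omit [DecidableEq d] in
/-- `‖x ↦ v x i‖_{L^q} ≤ ‖v‖_{L^q}`. [folklore] -/
theorem eLpNorm_coord_le (v : UnitAddTorus d → EuclideanSpace ℝ d) (q : ℝ≥0∞) (i : d) :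
    eLpNorm (fun x => v x i) q volume ≤ eLpNorm v q volume := by
  refine eLpNorm_mono fun x => ?_
  have h : |v x i| ≤ ‖v x‖ := by simpa using PiLp.norm_apply_le (v x) i
  rw [Real.norm_eq_abs]
  exact h

omit [DecidableEq d] in
/-- **Increments of the velocity tensor**: for `u ∈ L^q(T^d; ℝ^d)` and `1/q + 1/q = 1/r`,
`‖δ_h(uᵢuⱼ)‖_{L^r} ≤ 2 ‖u‖_{L^q} ‖δ_hu‖_{L^q}` (`δ_h(uᵢuⱼ) = δ_huᵢ · uⱼ(· + h) + uᵢ · δ_huⱼ`,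
Hölder). [cite: ConstantinETiti1994, (10)–(11)] -/
theorem eLpNorm_velTensor_increment_le {v : UnitAddTorus d → EuclideanSpace ℝ d} {q r : ℝ≥0∞}
    [ENNReal.HolderTriple q q r] (hr1 : 1 ≤ r) (hv : AEStronglyMeasurable v volume) (i j : d)
    (h : UnitAddTorus d) :
    eLpNorm (fun x => v (x + h) i * v (x + h) j - v x i * v x j) r volume ≤
      2 * eLpNorm v q volume * eLpNorm (fun x => v (x + h) - v x) q volume := by
  have hmp : MeasurePreserving (fun x : UnitAddTorus d => x + h) volume volume :=
    measurePreserving_add_right volume h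
  have hvh : AEStronglyMeasurable (fun x => v (x + h)) volume := hv.comp_measurePreserving hmp
  have hci : ∀ (w : UnitAddTorus d → EuclideanSpace ℝ d), AEStronglyMeasurable w volume → ∀ k : d,
      AEStronglyMeasurable (fun x => w x k) volume := fun w hw k =>
    (EuclideanSpace.proj k : EuclideanSpace ℝ d →L[ℝ] ℝ).continuous.comp_aestronglyMeasurable hw
  set δv : UnitAddTorus d → EuclideanSpace ℝ d := fun x => v (x + h) - v x with hδv
  have hδvm : AEStronglyMeasurable δv volume := hvh.sub hv
  have hsplit : (fun x => v (x + h) i * v (x + h) j - v x i * v x j) =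
      (fun x => δv x i * v (x + h) j) + fun x => v x i * δv x j := by
    funext x
    simp only [hδv, Pi.add_apply, PiLp.sub_apply]
    ring
  rw [hsplit]
  have e1 : (fun x => δv x i * v (x + h) j) = (fun x => δv x i) • fun x => v (x + h) j := rfl
  have e2 : (fun x => v x i * δv x j) = (fun x => v x i) • fun x => δv x j := rfl
  have h1 : eLpNorm (fun x => δv x i * v (x + h) j) r volume ≤
      eLpNorm (fun x => δv x i) q volume * eLpNorm (fun x => v (x + h) j) q volume := by
    rw [e1]
    exact eLpNorm_smul_le_mul_eLpNorm (hci _ hvh j) (hci _ hδvm i)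
  have h2 : eLpNorm (fun x => v x i * δv x j) r volume ≤
      eLpNorm (fun x => v x i) q volume * eLpNorm (fun x => δv x j) q volume := by
    rw [e2]
    exact eLpNorm_smul_le_mul_eLpNorm (hci _ hδvm j) (hci _ hv i)
  have h3 : eLpNorm (fun x => v (x + h) j) q volume ≤ eLpNorm v q volume :=
    (eLpNorm_coord_le _ q j).trans_eq (eLpNorm_comp_measurePreserving hv hmp)
  have h1' : eLpNorm (fun x => δv x i * v (x + h) j) r volume ≤ eLpNorm δv q volume * eLpNorm v q volume :=
    h1.trans (mul_le_mul' (eLpNorm_coord_le _ q i) h3)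
  have h2' : eLpNorm (fun x => v x i * δv x j) r volume ≤ eLpNorm v q volume * eLpNorm δv q volume :=
    h2.trans (mul_le_mul' (eLpNorm_coord_le _ q i) (eLpNorm_coord_le _ q j))
  have hadd : eLpNorm ((fun x => δv x i * v (x + h) j) + fun x => v x i * δv x j) r volume ≤
      eLpNorm (fun x => δv x i * v (x + h) j) r volume + eLpNorm (fun x => v x i * δv x j) r volume :=
    eLpNorm_add_le ((hci _ hδvm i).mul (hci _ hvh j)) ((hci _ hv i).mul (hci _ hδvm j)) hr1
  calc eLpNorm ((fun x => δv x i * v (x + h) j) + fun x => v x i * δv x j) r volume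
      ≤ eLpNorm δv q volume * eLpNorm v q volume + eLpNorm v q volume * eLpNorm δv q volume :=
        hadd.trans (add_le_add h1' h2')
    _ = 2 * eLpNorm v q volume * eLpNorm δv q volume := by ring

/-- The Hölder triple `(q, q, q/2)`: `1/q + 1/q = 2/q`. [folklore] -/
theorem holderTriple_self_half {q : ℝ≥0∞} (hq0 : q ≠ 0) (hqt : q ≠ ⊤) : ENNReal.HolderTriple q q (q / 2) := by
  refine ⟨?_⟩
  rw [ENNReal.inv_div (Or.inr hqt) (Or.inr hq0), ENNReal.div_eq_inv_mul, ← two_mul, mul_comm]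

/-- **Besov regularity of a distributional pressure** (De Rosa–Isett 2024, §3.4 / §5.1: the
pressure of a weak Euler solution in `L^q_t B^θ_{q,∞}` lies in `L^{q/2}_t B^θ_{q/2,∞}` by the
Calderón–Zygmund estimate on increments; here for *any* distributional pressure, which differs from
the Calderón–Zygmund one by a function of time). Let `(u, p)` be a distributional solution of the
unforced Navier–Stokes/Euler equations on `T^d × (0,T)` with `u(t) ∈ L^q(T^d)` for a.e. `t`,
`2 < q < ∞`. Then there is a finite constant `C_q` such that for a.e. `t ∈ (0,T)` and every `θ`,
`[p(t)]_{B^θ_{q/2,∞}} ≤ C_q ‖u(t)‖_{L^q} [u(t)]_{B^θ_{q,∞}}`. [cite: DeRosaIsett2024, §3.4 and §5.1 (est_II)] -/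
theorem _root_.Literature.Analysis.FluidPDE.Torus.IsDistributionalNSSolutionOn.ae_eBesovSupSeminorm_pressure_le
    [Nonempty d] (hsol : IsDistributionalNSSolutionOn T ν 0 u p) (hT : 0 < T) {q : ℝ≥0∞}
    (hq : 2 < q) (hq' : q ≠ ⊤)
    (huq : ∀ᵐ t ∂(volume.restrict (Ioo 0 T)), MemLp (u t) q volume) :
    ∃ Cq : ℝ≥0∞, Cq ≠ ⊤ ∧ ∀ᵐ t ∂(volume.restrict (Ioo 0 T)), ∀ θ : ℝ,
      eBesovSupSeminorm θ (q / 2) (p t) volume ≤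
        Cq * eLpNorm (u t) q volume * eBesovSupSeminorm θ q (u t) volume := by
  set r : ℝ≥0∞ := q / 2 with hr
  have hq0 : q ≠ 0 := (lt_trans (by norm_num) hq).ne'
  haveI hHT : ENNReal.HolderTriple q q r := holderTriple_self_half hq0 hq'
  have hr1 : 1 < r := by
    rw [hr, ENNReal.lt_div_iff_mul_lt (Or.inl (by norm_num)) (Or.inl (by norm_num)), one_mul]
    exact hq
  have hrt : r ≠ ⊤ := ENNReal.div_ne_top hq' (by norm_num)
  have hr0 : r ≠ 0 := (zero_lt_one.trans hr1).ne'
  have hrr : 0 < r.toReal := ENNReal.toReal_pos hr0 hrt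
  obtain ⟨C, hC⟩ := hessianBound_of_fact (eLpNorm_hessian_le_laplacian_holds (d := d)) hr1 hrt.lt_top
  set K : ℝ≥0∞ := presConst d r C with hK
  have hKt : K < ⊤ := presConst_lt_top hr1.le hrt
  set n : ℝ≥0∞ := (Fintype.card d : ℝ≥0∞) with hn
  set Cq : ℝ≥0∞ := 4 * (K * n ^ 2) ^ (1 / r.toReal) with hCq
  have hCqt : Cq ≠ ⊤ := by
    refine ENNReal.mul_ne_top (by norm_num) (ENNReal.rpow_ne_top_of_nonneg (by positivity) ?_)
    exact ENNReal.mul_ne_top hKt.ne (ENNReal.pow_ne_top (ENNReal.natCast_ne_top _))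
  refine ⟨Cq, hCqt, ?_⟩
  -- a countable dense set of centres and the Poisson identities along it, simultaneously in `t`
  obtain ⟨D, hDc, hDd⟩ := TopologicalSpace.exists_countable_dense (UnitAddTorus d)
  haveI : Countable D := hDc.to_subtype
  have hrpos : ∀ m : ℕ, (0 : ℝ) < 1 / ((m : ℝ) + 4) := fun m => by positivity
  have hrle : ∀ m : ℕ, 1 / ((m : ℝ) + 4) ≤ (1 / 4 : ℝ) := fun m => by
    rw [div_le_div_iff₀ (by positivity) (by norm_num)]
    linarith [m.cast_nonneg (α := ℝ)]
  have hθs : ∀ (m : ℕ) (x : UnitAddTorus d), IsSmooth (fun z => kernel (1 / ((m : ℝ) + 4)) (x - z)) :=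
    fun m x => (isSmooth_kernel (hrpos m) (hrle m)).comp_sub_left x
  have hP : ∀ᵐ t ∂(volume.restrict (Ioo 0 T)), ∀ (m : ℕ) (x : D),
      ∫ y, p t y * Torus.laplacian (fun z => kernel (1 / ((m : ℝ) + 4)) ((x : UnitAddTorus d) - z)) y =
        -∑ i, ∑ j, ∫ y, u t y i * u t y j * Torus.partialDeriv i (Torus.partialDeriv j
          (fun z => kernel (1 / ((m : ℝ) + 4)) ((x : UnitAddTorus d) - z))) y :=
    ae_all_iff.2 fun m => ae_all_iff.2 fun x => hsol.ae_integral_pressure_mul_laplacian hT (hθs m x)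
  have hpint : ∀ᵐ t ∂(volume.restrict (Ioo 0 T)), Integrable (p t) volume :=
    ae_integrable_slice_of_lintegral (aestronglyMeasurable_uncurry_prod hsol.2.2.1) hsol.2.2.2.1
  filter_upwards [hP, hpint, huq] with t hPt htp htq θ
  -- the Calderón–Zygmund pressure of the slice
  set G : d → d → UnitAddTorus d → ℝ := fun i j x => u t x i * u t x j with hG
  have hGp : ∀ i j, MemLp (G i j) r volume := fun i j => (htq.eval_piLp j).mul' (htq.eval_piLp i)
  have hGf : ∀ i j, ∫⁻ x, ‖G i j x‖ₑ ^ r.toReal < ⊤ := fun i j =>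
    lintegral_rpow_enorm_lt_top_of_eLpNorm_lt_top hr0 hrt (hGp i j).eLpNorm_lt_top
  obtain ⟨π, hπm, hπb, hπw⟩ := exists_slicePressure hr1.le hrt hC (fun i j => (hGp i j).1) hGf
  have hπp : MemLp π r volume := by
    refine memLp_of_lintegral_rpow_enorm_lt_top hr0 hrt hπm (hπb.trans_lt ?_)
    refine ENNReal.mul_lt_top hKt (ENNReal.sum_lt_top.2 fun i _ => ENNReal.sum_lt_top.2 fun j _ => hGf i j)
  have hπi : Integrable π volume := hπp.integrable hr1.le
  -- `p(t) - π` is weakly harmonic along the countable family, hence a.e. constant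
  set F : UnitAddTorus d → ℝ := fun y => p t y - π y with hF
  have hFi : Integrable F volume := htp.sub hπi
  have hFae : F =ᵐ[volume] fun _ => ∫ y, F y := by
    refine ae_eq_const_of_forall_integral_mul_laplacian_kernel_eq_zero hFi hDd fun m x hx => ?_
    have h1 := hPt m ⟨x, hx⟩
    have h2 := hπw _ (hθs m x)
    have hΔc : Continuous (Torus.laplacian (fun z => kernel (1 / ((m : ℝ) + 4)) (x - z))) :=
      (hθs m x).laplacian.continuous
    have i1 := integrable_mul_continuous_real htp hΔc
    have i2 := integrable_mul_continuous_real hπi hΔc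
    have e : (fun y => F y * Torus.laplacian (fun z => kernel (1 / ((m : ℝ) + 4)) (x - z)) y) =
        fun y => p t y * Torus.laplacian (fun z => kernel (1 / ((m : ℝ) + 4)) (x - z)) y -
          π y * Torus.laplacian (fun z => kernel (1 / ((m : ℝ) + 4)) (x - z)) y := by
      funext y
      simp only [hF]
      ring
    rw [e, integral_sub i1 i2, h1, h2]
    simp only [hG, sub_self]
  -- increments of `p(t)` are increments of `π`
  set c : ℝ := ∫ y, F y with hc
  have hincr : ∀ h : UnitAddTorus d,
      eLpNorm (fun x => p t (x + h) - p t x) r volume = eLpNorm (fun x => π (x + h) - π x) r volume := by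
    intro h
    have hmp : MeasurePreserving (fun x : UnitAddTorus d => x + h) volume volume :=
      measurePreserving_add_right volume h
    have h1 : (fun x => F (x + h)) =ᵐ[volume] fun _ => c := hmp.quasiMeasurePreserving.ae_eq_comp hFae
    refine eLpNorm_congr_ae ?_
    filter_upwards [hFae, h1] with x hx hxh
    have ex : p t x - π x = c := hx
    have exh : p t (x + h) - π (x + h) = c := hxh
    linarith
  -- the increment bound
  have hbound : ∀ h : UnitAddTorus d, eLpNorm (fun x => p t (x + h) - p t x) r volume ≤
      Cq * eLpNorm (u t) q volume * eLpNorm (fun x => u t (x + h) - u t x) q volume := by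
    intro h
    set A : ℝ≥0∞ := 2 * eLpNorm (u t) q volume * eLpNorm (fun x => u t (x + h) - u t x) q volume with hA
    have hGA : ∀ i j, ∫⁻ x, ‖G i j (x + h) - G i j x‖ₑ ^ r.toReal ≤ A ^ r.toReal := by
      intro i j
      rw [lintegral_rpow_enorm_eq_eLpNorm_rpow hr0 hrt]
      refine ENNReal.rpow_le_rpow ?_ hrr.le
      exact eLpNorm_velTensor_increment_le hr1.le htq.1 i j h
    have hsum : presConst d r C * ∑ i, ∑ j, ∫⁻ x, ‖G i j (x + h) - G i j x‖ₑ ^ r.toReal ≤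
        (K * n ^ 2) * A ^ r.toReal := by
      calc presConst d r C * ∑ i, ∑ j, ∫⁻ x, ‖G i j (x + h) - G i j x‖ₑ ^ r.toReal
          ≤ K * ∑ _i : d, ∑ _j : d, A ^ r.toReal := by
            gcongr with i _ j _
            exact hGA i j
        _ = (K * n ^ 2) * A ^ r.toReal := by
            rw [Finset.sum_const, Finset.sum_const, Finset.card_univ, nsmul_eq_mul, nsmul_eq_mul, hn]
            ring
    have hroot : ((K * n ^ 2) * A ^ r.toReal) ^ (1 / r.toReal) = (K * n ^ 2) ^ (1 / r.toReal) * A := by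
      rw [ENNReal.mul_rpow_of_nonneg _ _ (by positivity), one_div, ENNReal.rpow_rpow_inv hrr.ne']
    calc eLpNorm (fun x => p t (x + h) - p t x) r volume
        = eLpNorm (fun x => π (x + h) - π x) r volume := hincr h
      _ ≤ 2 * (presConst d r C * ∑ i, ∑ j, ∫⁻ x, ‖G i j (x + h) - G i j x‖ₑ ^ r.toReal) ^ (1 / r.toReal) :=
          eLpNorm_translate_sub_le_of_poisson hr1.le hrt hC hπi hGp hπw h
      _ ≤ 2 * ((K * n ^ 2) * A ^ r.toReal) ^ (1 / r.toReal) := by gcongr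
      _ = 2 * ((K * n ^ 2) ^ (1 / r.toReal) * A) := by rw [hroot]
      _ = Cq * eLpNorm (u t) q volume * eLpNorm (fun x => u t (x + h) - u t x) q volume := by
          rw [hA, hCq]
          ring
  -- the Besov seminorm bound
  unfold eBesovSupSeminorm eDiffQuotient
  refine iSup₂_le fun h hh => ?_
  calc eLpNorm (fun x => p t (x + h) - p t x) r volume / ENNReal.ofReal (‖h‖ ^ θ)
      ≤ (Cq * eLpNorm (u t) q volume * eLpNorm (fun x => u t (x + h) - u t x) q volume) /
          ENNReal.ofReal (‖h‖ ^ θ) := ENNReal.div_le_div_right (hbound h) _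
    _ = Cq * eLpNorm (u t) q volume * (eLpNorm (fun x => u t (x + h) - u t x) q volume /
          ENNReal.ofReal (‖h‖ ^ θ)) := mul_div_assoc _ _ _
    _ ≤ Cq * eLpNorm (u t) q volume *
          ⨆ (h : UnitAddTorus d) (_ : h ≠ 0), eLpNorm (fun x => u t (x + h) - u t x) q volume /
            ENNReal.ofReal (‖h‖ ^ θ) := by
          gcongr
          exact le_iSup₂ (f := fun (h : UnitAddTorus d) (_ : h ≠ 0) =>
            eLpNorm (fun x => u t (x + h) - u t x) q volume / ENNReal.ofReal (‖h‖ ^ θ)) h hh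

end Distributional


end Literature.Analysis.FluidPDE.Torus

end
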